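import Summits.AtomisticToContinuum.HydrodynamicLimit.Theorems.CollisionIsometryCLTAdaptedWeightCLTBHDVTransferHellinger

/-!
# Stub `stub_eepClosure` (S5) of the line `block-h-dissipation-closure`, helper file 4: the ENTROPY PRODUCTION is
controlled by the HELLINGER DISSIPATION plus a tail
(crux `CollisionIsometryCLT.AdaptedWeightCLT`, stmt-AtomisticToContinuum-14868; `--supports`)

Step (i) of the planner's sketch of `stub_eepClosure`, for a general positive measurable velocity density `f` on
`ℝ³` whose logarithm is controlled by a co-moving Gaussian envelope, `|log f(w)| ≤ A + |w − u|²/(2h²)` (the shape the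
regularised cell law has: bounded above by the peak of the mollifier, below by `δ` times its Maxwellian floor):
* POINTWISE (`sub_mul_log_div_le`): for `a, b > 0` and every `L > 0`, `W ≥ |log(a/b)|`,
  `(a − b) log(a/b) ≤ 3 (2 + L) (√a − √b)² + (a + b) W²/L` — on `{|log(a/b)| ≤ L}` by the elementary
  `(a − b) log(a/b) ≤ 3 (2 + |log(a/b)|)(√a − √b)²` (`sub_mul_log_div_le_sqrt`, from
  `(s² − 1) log s ≤ 3 (1 + |log s|)(s − 1)²`, `core_log_ineq`), on the complement by `1 ≤ W/L`;
* INTEGRATED (`entropyProduction_le`): with `a = f′f′_*`, `b = f f_*`, the collision-invariant weight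
  `W = 4A + (|v−u|² + |v_*−u|²)/h²` dominates `|log(a/b)|` (energy conservation about `u`), so for every `L > 0`
  `D(f) ≤ (3/2)(2 + L) · Z(f) · 𝒟h(f) + J/(2L)`, `J = ∫ B f f_* W²`
  (`D = entropyProduction hardSphereKernel`, `Z = fluxZ`, `𝒟h = hellDiss` of the vocabulary; the post-collisional
  copy of `J` equals `J` by the flux-preserving involution, landed `DVTransfer.integral_kernel_mul_comp_collideSwap`).
  If the entropy-production integrand is not integrable the Bochner value `D(f) = 0` only helps.
No definitions. Registered anchor: `bhEEPClosure_entropy_anchor` (the pointwise inequality, `∀`-closed).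
-/

namespace Summit.AtomisticToContinuum.HydrodynamicLimit.Theorems.BlockHDissipation

open scoped BigOperators Topology Classical MeasureTheory ENNReal InnerProductSpace
open Filter Set MeasureTheory Real
open Literature.Analysis.FluidPDE
open Summit.AtomisticToContinuum.HydrodynamicLimit.Theorems.ContactSourceDuhamel (T3 V3 Cfg Vel Flow Flows)
open Literature.MathematicalPhysics.KineticTheory (collide hardSphereKernel sphereMeasure)

noncomputable section

namespace EEP

/-! ## The pointwise inequality -/

/-- **Core inequality**: `(s² − 1) log s ≤ 3 (1 + |log s|) (s − 1)²` for `s > 0`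
(from `1 − 1/s ≤ log s ≤ s − 1`, in the four ranges `s ≤ 1/2`, `1/2 < s < 1`, `1 ≤ s < 2`, `2 ≤ s`). -/
theorem core_log_ineq {s : ℝ} (hs : 0 < s) : (s ^ 2 - 1) * log s ≤ 3 * (1 + |log s|) * (s - 1) ^ 2 := by
  have hup : log s ≤ s - 1 := Real.log_le_sub_one_of_pos hs
  have hlow : 1 - s⁻¹ ≤ log s := Real.one_sub_inv_le_log_of_pos hs
  rcases le_or_gt 1 s with h1 | h1
  · -- `s ≥ 1`: `log s ≥ 0`
    have hl0 : 0 ≤ log s := Real.log_nonneg h1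
    rw [abs_of_nonneg hl0]
    -- goal: (s²−1) log s ≤ 3(1 + log s)(s−1)²  ⟸  (s−1)[3(s−1) + (2s−4) log s] ≥ 0
    rcases le_or_gt 2 s with h2 | h2
    · nlinarith [mul_nonneg (sub_nonneg.2 h1) hl0, mul_nonneg (sub_nonneg.2 h2) hl0,
        mul_nonneg (mul_nonneg (sub_nonneg.2 h1) (sub_nonneg.2 h2)) hl0]
    · -- `1 ≤ s < 2`: use `log s ≤ s − 1` on the negative coefficient `2s − 4`
      have hkey : (2 * s - 4) * (s - 1) ≤ (2 * s - 4) * log s :=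
        mul_le_mul_of_nonpos_left hup (by linarith)
      nlinarith [mul_nonneg (sub_nonneg.2 h1) hl0, sub_nonneg.2 h1, hkey,
        mul_le_mul_of_nonneg_left hkey (sub_nonneg.2 h1)]
  · -- `s < 1`: `log s < 0`
    have hl0 : log s ≤ 0 := Real.log_nonpos hs.le h1.le
    rw [abs_of_nonpos hl0]
    have hinv : s⁻¹ = 1 / s := inv_eq_one_div s
    rcases le_or_gt s (1 / 2) with h2 | h2
    · -- `s ≤ 1/2`: both `3(1−s)` and `(−log s)(2 − 4s)` are nonnegative
      nlinarith [mul_nonneg (sub_nonneg.2 h1.le) (neg_nonneg.2 hl0), sub_nonneg.2 h1.le,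
        mul_nonneg (mul_nonneg (sub_nonneg.2 h1.le) (neg_nonneg.2 hl0)) (by linarith : (0 : ℝ) ≤ 2 - 4 * s),
        mul_nonneg (sub_nonneg.2 h1.le) (sub_nonneg.2 h1.le)]
    · -- `1/2 < s < 1`: use `−log s ≤ (1 − s)/s` on the negative coefficient `2 − 4s`
      have hls : -log s * s ≤ 1 - s := by
        have := mul_le_mul_of_nonneg_right hlow hs.le
        rw [sub_mul, inv_mul_cancel₀ hs.ne', one_mul] at this
        linarith
      have hcoef : (2 - 4 * s) ≤ 0 := by linarith
      -- multiply the target by `s > 0`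
      have hmain : 0 ≤ s * (3 * (1 - s) + (-log s) * (2 - 4 * s)) := by
        have : (2 - 4 * s) * (1 - s) ≤ (2 - 4 * s) * (-log s * s) := mul_le_mul_of_nonpos_left hls hcoef
        nlinarith [this, hs]
      have hpos : 0 ≤ 3 * (1 - s) + (-log s) * (2 - 4 * s) := (mul_nonneg_iff_of_pos_left hs).1 hmain
      nlinarith [mul_nonneg (sub_nonneg.2 h1.le) hpos]

/-- `(a − b) log(a/b) ≤ 3 (2 + |log(a/b)|)(√a − √b)²` for `a, b > 0` (substitute `s = √a/√b` in `core_log_ineq`). -/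
theorem sub_mul_log_div_le_sqrt {a b : ℝ} (ha : 0 < a) (hb : 0 < b) :
    (a - b) * log (a / b) ≤ 3 * (2 + |log (a / b)|) * (Real.sqrt a - Real.sqrt b) ^ 2 := by
  set x := Real.sqrt a with hx
  set y := Real.sqrt b with hy
  have hx0 : 0 < x := Real.sqrt_pos.2 ha
  have hy0 : 0 < y := Real.sqrt_pos.2 hb
  have hxa : x ^ 2 = a := Real.sq_sqrt ha.le
  have hyb : y ^ 2 = b := Real.sq_sqrt hb.le
  set s := x / y with hs
  have hs0 : 0 < s := div_pos hx0 hy0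
  have hxs : x = s * y := by rw [hs, div_mul_cancel₀ _ hy0.ne']
  have hlog : log (a / b) = 2 * log s := by
    rw [← hxa, ← hyb, ← div_pow, ← hs, Real.log_pow]; norm_num
  have hcore := core_log_ineq hs0
  rw [hlog, ← hxa, ← hyb, hxs]
  have h2 : |2 * log s| = 2 * |log s| := by rw [abs_mul, abs_two]
  rw [h2]
  have hy2 : 0 < y ^ 2 := pow_pos hy0 2
  -- both sides are `y²` times the core inequality (up to the factor 2)
  have : ((s * y) ^ 2 - y ^ 2) * (2 * log s) = y ^ 2 * (2 * ((s ^ 2 - 1) * log s)) := by ring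
  rw [this]
  have : 3 * (2 + 2 * |log s|) * (s * y - y) ^ 2 = y ^ 2 * (2 * (3 * (1 + |log s|) * (s - 1) ^ 2)) := by ring
  rw [this]
  exact mul_le_mul_of_nonneg_left (by linarith) hy2.le

/-- **Pointwise inequality with a dominating weight**: for `a, b > 0`, `L > 0` and `W ≥ |log(a/b)|`,
`(a − b) log(a/b) ≤ 3 (2 + L)(√a − √b)² + (a + b) W²/L`. -/
theorem sub_mul_log_div_le {a b L W : ℝ} (ha : 0 < a) (hb : 0 < b) (hL : 0 < L) (hW : |log (a / b)| ≤ W) :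
    (a - b) * log (a / b) ≤ 3 * (2 + L) * (Real.sqrt a - Real.sqrt b) ^ 2 + (a + b) * W ^ 2 / L := by
  have hW0 : 0 ≤ W := (abs_nonneg _).trans hW
  have hsq : 0 ≤ (Real.sqrt a - Real.sqrt b) ^ 2 := sq_nonneg _
  have htail : 0 ≤ (a + b) * W ^ 2 / L := by positivity
  rcases le_or_gt (|log (a / b)|) L with h | h
  · calc (a - b) * log (a / b) ≤ 3 * (2 + |log (a / b)|) * (Real.sqrt a - Real.sqrt b) ^ 2 :=
          sub_mul_log_div_le_sqrt ha hb
      _ ≤ 3 * (2 + L) * (Real.sqrt a - Real.sqrt b) ^ 2 := by gcongr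
      _ ≤ _ := le_add_of_nonneg_right htail
  · -- `|log(a/b)| > L`: `(a−b) log(a/b) ≤ (a+b)|log(a/b)| ≤ (a+b) W ≤ (a+b) W · (W/L)`
    have h1 : (a - b) * log (a / b) ≤ (a + b) * |log (a / b)| := by
      calc (a - b) * log (a / b) ≤ |(a - b) * log (a / b)| := le_abs_self _
        _ = |a - b| * |log (a / b)| := abs_mul _ _
        _ ≤ (a + b) * |log (a / b)| := by
            refine mul_le_mul_of_nonneg_right ?_ (abs_nonneg _)
            exact (abs_sub _ _).trans (by rw [abs_of_pos ha, abs_of_pos hb])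
    have hWL : 1 ≤ W / L := by rw [le_div_iff₀ hL]; linarith
    calc (a - b) * log (a / b) ≤ (a + b) * |log (a / b)| := h1
      _ ≤ (a + b) * W := mul_le_mul_of_nonneg_left hW (by positivity)
      _ ≤ (a + b) * W * (W / L) := le_mul_of_one_le_right (by positivity) hWL
      _ = (a + b) * W ^ 2 / L := by ring
      _ ≤ _ := le_add_of_nonneg_left (by positivity)

/-! ## The integrated inequality -/

section Integrated

variable {f : V3 → ℝ} {u : V3} {h A : ℝ}

/-- The co-moving energy weight `W(v, v_*) = 4A + (|v−u|² + |v_*−u|²)/h²`. -/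
theorem weight_collide_eq (u : V3) (h A : ℝ) (ω : Metric.sphere (0 : V3) 1) (p : V3 × V3) :
    4 * A + (‖(collide ω p).1 - u‖ ^ 2 + ‖(collide ω p).2 - u‖ ^ 2) / h ^ 2 =
      4 * A + (‖p.1 - u‖ ^ 2 + ‖p.2 - u‖ ^ 2) / h ^ 2 := by
  have h1 := DVTransfer.collide_sub_const ω p u
  have h2 := Literature.MathematicalPhysics.KineticTheory.norm_sq_collide_fst_add_norm_sq_collide_snd ω (p.1 - u, p.2 - u)
  rw [h1] at h2
  simp only at h2
  rw [h2]

/-- The weight dominates the log-ratio: if `|log f(w)| ≤ A + |w−u|²/(2h²)` for all `w`, then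
`|log(f′f′_*/(f f_*))| ≤ 4A + (|v−u|² + |v_*−u|²)/h²`. -/
theorem abs_log_ratio_le (hf : ∀ w, 0 < f w) (hlog : ∀ w, |log (f w)| ≤ A + ‖w - u‖ ^ 2 / (2 * h ^ 2))
    (ω : Metric.sphere (0 : V3) 1) (p : V3 × V3) :
    |log (f (collide ω p).1 * f (collide ω p).2 / (f p.1 * f p.2))| ≤
      4 * A + (‖p.1 - u‖ ^ 2 + ‖p.2 - u‖ ^ 2) / h ^ 2 := by
  have e1 := hf (collide ω p).1
  have e2 := hf (collide ω p).2
  have e3 := hf p.1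
  have e4 := hf p.2
  rw [Real.log_div (mul_pos e1 e2).ne' (mul_pos e3 e4).ne', Real.log_mul e1.ne' e2.ne', Real.log_mul e3.ne' e4.ne']
  have hen := Literature.MathematicalPhysics.KineticTheory.norm_sq_collide_fst_add_norm_sq_collide_snd ω (p.1 - u, p.2 - u)
  rw [DVTransfer.collide_sub_const ω p u] at hen
  calc |log (f (collide ω p).1) + log (f (collide ω p).2) - (log (f p.1) + log (f p.2))|
      ≤ |log (f (collide ω p).1)| + |log (f (collide ω p).2)| + (|log (f p.1)| + |log (f p.2)|) := by
        refine (abs_sub _ _).trans (add_le_add (abs_add_le _ _) (abs_add_le _ _))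
    _ ≤ (A + ‖(collide ω p).1 - u‖ ^ 2 / (2 * h ^ 2)) + (A + ‖(collide ω p).2 - u‖ ^ 2 / (2 * h ^ 2)) +
          ((A + ‖p.1 - u‖ ^ 2 / (2 * h ^ 2)) + (A + ‖p.2 - u‖ ^ 2 / (2 * h ^ 2))) :=
        add_le_add (add_le_add (hlog _) (hlog _)) (add_le_add (hlog _) (hlog _))
    _ = 4 * A + (‖p.1 - u‖ ^ 2 + ‖p.2 - u‖ ^ 2) / h ^ 2 := by
        simp only at hen
        linear_combination (1 / (2 * h ^ 2)) * hen

/-- **ENTROPY PRODUCTION ≤ HELLINGER DISSIPATION + TAIL.** Let `f > 0` be measurable on `ℝ³` with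
`|log f(w)| ≤ A + |w−u|²/(2h²)`, `B f f_*` integrable and `J = ∫ B f f_* W²` integrable,
`W = 4A + (|v−u|² + |v_*−u|²)/h²`. Then for every `L > 0`:
`D(f) ≤ (3/2)(2 + L) · Z(f) · 𝒟h(f) + J/(2L)`. -/
theorem entropyProduction_le (hfm : Measurable f) (hf : ∀ w, 0 < f w)
    (hlog : ∀ w, |log (f w)| ≤ A + ‖w - u‖ ^ 2 / (2 * h ^ 2))
    (hint : Integrable (fun q : PairDir => hardSphereKernel q.1 q.2 * (f q.1.1 * f q.1.2)) pairDirMeasure)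
    (hintW : Integrable (fun q : PairDir => hardSphereKernel q.1 q.2 * (f q.1.1 * f q.1.2) *
      (4 * A + (‖q.1.1 - u‖ ^ 2 + ‖q.1.2 - u‖ ^ 2) / h ^ 2) ^ 2) pairDirMeasure)
    {L : ℝ} (hL : 0 < L) :
    entropyProduction hardSphereKernel f ≤
      3 / 2 * (2 + L) * (fluxZ f * hellDiss f) +
        (∫ q : PairDir, hardSphereKernel q.1 q.2 * (f q.1.1 * f q.1.2) *
          (4 * A + (‖q.1.1 - u‖ ^ 2 + ‖q.1.2 - u‖ ^ 2) / h ^ 2) ^ 2 ∂pairDirMeasure) / (2 * L) := by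
  -- shorthand (in comments): `K = B(q)`, `α = f′f′_*`, `β = f f_*`, `W = 4A + (|v−u|²+|v_*−u|²)/h²`
  have hB0 : ∀ q : PairDir, 0 ≤ hardSphereKernel q.1 q.2 := fun q => le_max_right _ _
  have ha0 : ∀ q : PairDir, 0 < f (collide q.2 q.1).1 * f (collide q.2 q.1).2 := fun q => mul_pos (hf _) (hf _)
  have hb0 : ∀ q : PairDir, 0 < f q.1.1 * f q.1.2 := fun q => mul_pos (hf _) (hf _)
  have hf0 : ∀ w, 0 ≤ f w := fun w => (hf w).le
  -- the Hellinger integral `Hl` and the tail integral `J`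
  obtain ⟨Hl, hHl⟩ : ∃ Hl : ℝ, Hl = ∫ q : PairDir, hardSphereKernel q.1 q.2 *
      (Real.sqrt (f (collide q.2 q.1).1 * f (collide q.2 q.1).2) - Real.sqrt (f q.1.1 * f q.1.2)) ^ 2
      ∂pairDirMeasure := ⟨_, rfl⟩
  obtain ⟨J, hJ⟩ : ∃ J : ℝ, J = ∫ q : PairDir, hardSphereKernel q.1 q.2 * (f q.1.1 * f q.1.2) *
      (4 * A + (‖q.1.1 - u‖ ^ 2 + ‖q.1.2 - u‖ ^ 2) / h ^ 2) ^ 2 ∂pairDirMeasure := ⟨_, rfl⟩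
  rw [← hJ]
  -- (1) the Hellinger integral is `2 Z 𝒟h`
  have hHl_eq : Hl = 2 * (fluxZ f * hellDiss f) := by
    by_cases hZ : fluxZ f = 0
    · -- then the Hellinger integral vanishes too (it is `≤ 2 Z`)
      have hsq : 0 ≤ Hl := by rw [hHl]; exact integral_nonneg fun q => mul_nonneg (hB0 q) (sq_nonneg _)
      have hcross : 0 ≤ ∫ q : PairDir, hardSphereKernel q.1 q.2 *
          Real.sqrt (f q.1.1 * f q.1.2 * (f (collide q.2 q.1).1 * f (collide q.2 q.1).2)) ∂pairDirMeasure :=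
        integral_nonneg fun q => mul_nonneg (hB0 q) (Real.sqrt_nonneg _)
      rw [hHl, DVTransfer.integral_hellingerSq_eq hfm hf0 hint, hZ] at hsq ⊢
      linarith
    · rw [hellDiss, ← hHl]
      field_simp
  -- (2) integrability of the pieces
  have hIa := DVTransfer.integrable_kernel_mul_pair_collide hint
  have hIsqrt := DVTransfer.integrable_kernel_mul_sqrt hfm hf0 hint
  have hIHl : Integrable (fun q : PairDir => hardSphereKernel q.1 q.2 *
      (Real.sqrt (f (collide q.2 q.1).1 * f (collide q.2 q.1).2) - Real.sqrt (f q.1.1 * f q.1.2)) ^ 2)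
      pairDirMeasure := by
    have : (fun q : PairDir => hardSphereKernel q.1 q.2 *
        (Real.sqrt (f (collide q.2 q.1).1 * f (collide q.2 q.1).2) - Real.sqrt (f q.1.1 * f q.1.2)) ^ 2) =
        fun q => hardSphereKernel q.1 q.2 * (f (collide q.2 q.1).1 * f (collide q.2 q.1).2) +
          hardSphereKernel q.1 q.2 * (f q.1.1 * f q.1.2) -
          2 * (hardSphereKernel q.1 q.2 *
            Real.sqrt (f q.1.1 * f q.1.2 * (f (collide q.2 q.1).1 * f (collide q.2 q.1).2))) := by
      funext q
      rw [DVTransfer.sqrt_sub_sqrt_sq (hb0 q).le (ha0 q).le]; ring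
    rw [this]
    exact (hIa.add hint).sub (hIsqrt.const_mul 2)
  have hIJa : Integrable (fun q : PairDir => hardSphereKernel q.1 q.2 * (f (collide q.2 q.1).1 * f (collide q.2 q.1).2) *
      (4 * A + (‖q.1.1 - u‖ ^ 2 + ‖q.1.2 - u‖ ^ 2) / h ^ 2) ^ 2) pairDirMeasure := by
    have hiff := DVTransfer.integrable_kernel_mul_comp_collide_iff
      (fun p : V3 × V3 => f p.1 * f p.2 * (4 * A + (‖p.1 - u‖ ^ 2 + ‖p.2 - u‖ ^ 2) / h ^ 2) ^ 2)
    have h2 : Integrable (fun q : PairDir => hardSphereKernel q.1 q.2 *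
        (f q.1.1 * f q.1.2 * (4 * A + (‖q.1.1 - u‖ ^ 2 + ‖q.1.2 - u‖ ^ 2) / h ^ 2) ^ 2)) pairDirMeasure :=
      hintW.congr (Eventually.of_forall fun q => by ring)
    refine (hiff.2 h2).congr (Eventually.of_forall fun q => ?_)
    simp only [Prod.fst_swap, Prod.snd_swap]
    rw [add_comm (‖(collide q.2 q.1).2 - u‖ ^ 2), weight_collide_eq u h A q.2 q.1]
    ring
  -- (3) the post-collisional tail integral equals `J` (flux-preserving involution, `W` collision invariant)
  have hJ' : ∫ q : PairDir, hardSphereKernel q.1 q.2 * (f (collide q.2 q.1).1 * f (collide q.2 q.1).2) *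
      (4 * A + (‖q.1.1 - u‖ ^ 2 + ‖q.1.2 - u‖ ^ 2) / h ^ 2) ^ 2 ∂pairDirMeasure = J := by
    have hsw := DVTransfer.integral_kernel_mul_comp_collideSwap
      (fun p : V3 × V3 => f p.1 * f p.2 * (4 * A + (‖p.1 - u‖ ^ 2 + ‖p.2 - u‖ ^ 2) / h ^ 2) ^ 2)
    rw [hJ]
    have hR : ∫ q : PairDir, hardSphereKernel q.1 q.2 * (f q.1.1 * f q.1.2) *
        (4 * A + (‖q.1.1 - u‖ ^ 2 + ‖q.1.2 - u‖ ^ 2) / h ^ 2) ^ 2 ∂pairDirMeasure =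
        ∫ q : PairDir, hardSphereKernel q.1 q.2 *
          (f q.1.1 * f q.1.2 * (4 * A + (‖q.1.1 - u‖ ^ 2 + ‖q.1.2 - u‖ ^ 2) / h ^ 2) ^ 2) ∂pairDirMeasure :=
      integral_congr_ae (Eventually.of_forall fun q => by ring)
    rw [hR, ← hsw]
    refine integral_congr_ae (Eventually.of_forall fun q => ?_)
    simp only [Prod.fst_swap, Prod.snd_swap]
    rw [add_comm (‖(collide q.2 q.1).2 - u‖ ^ 2), weight_collide_eq u h A q.2 q.1]
    ring
  -- (4) the pointwise inequality, multiplied by `B ≥ 0`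
  have hpt : ∀ q : PairDir, hardSphereKernel q.1 q.2 *
      ((f (collide q.2 q.1).1 * f (collide q.2 q.1).2 - f q.1.1 * f q.1.2) *
        log (f (collide q.2 q.1).1 * f (collide q.2 q.1).2 / (f q.1.1 * f q.1.2))) ≤
      3 * (2 + L) * (hardSphereKernel q.1 q.2 *
        (Real.sqrt (f (collide q.2 q.1).1 * f (collide q.2 q.1).2) - Real.sqrt (f q.1.1 * f q.1.2)) ^ 2) +
      (hardSphereKernel q.1 q.2 * (f (collide q.2 q.1).1 * f (collide q.2 q.1).2) *
          (4 * A + (‖q.1.1 - u‖ ^ 2 + ‖q.1.2 - u‖ ^ 2) / h ^ 2) ^ 2 +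
        hardSphereKernel q.1 q.2 * (f q.1.1 * f q.1.2) *
          (4 * A + (‖q.1.1 - u‖ ^ 2 + ‖q.1.2 - u‖ ^ 2) / h ^ 2) ^ 2) / L := by
    intro q
    have hW := abs_log_ratio_le hf hlog q.2 q.1
    have h1 := mul_le_mul_of_nonneg_left (sub_mul_log_div_le (ha0 q) (hb0 q) hL hW) (hB0 q)
    refine h1.trans (le_of_eq ?_)
    ring
  -- (5) integrate the right-hand side
  have hRHS1 := hIHl.const_mul (3 * (2 + L))
  have hRHS2 := (hIJa.fun_add hintW).div_const L
  have hintRHS : ∫ q : PairDir, (3 * (2 + L) * (hardSphereKernel q.1 q.2 *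
        (Real.sqrt (f (collide q.2 q.1).1 * f (collide q.2 q.1).2) - Real.sqrt (f q.1.1 * f q.1.2)) ^ 2) +
      (hardSphereKernel q.1 q.2 * (f (collide q.2 q.1).1 * f (collide q.2 q.1).2) *
          (4 * A + (‖q.1.1 - u‖ ^ 2 + ‖q.1.2 - u‖ ^ 2) / h ^ 2) ^ 2 +
        hardSphereKernel q.1 q.2 * (f q.1.1 * f q.1.2) *
          (4 * A + (‖q.1.1 - u‖ ^ 2 + ‖q.1.2 - u‖ ^ 2) / h ^ 2) ^ 2) / L) ∂pairDirMeasure =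
      3 * (2 + L) * Hl + (J + J) / L := by
    rw [integral_add hRHS1 hRHS2, integral_const_mul, integral_div, integral_add hIJa hintW, hJ', ← hHl, ← hJ]
  -- the entropy production, with or without integrability of its integrand
  have hmain : ∫ q : PairDir, hardSphereKernel q.1 q.2 *
      ((f (collide q.2 q.1).1 * f (collide q.2 q.1).2 - f q.1.1 * f q.1.2) *
        log (f (collide q.2 q.1).1 * f (collide q.2 q.1).2 / (f q.1.1 * f q.1.2))) ∂pairDirMeasure ≤
      3 * (2 + L) * Hl + (J + J) / L := by
    by_cases hI : Integrable (fun q : PairDir => hardSphereKernel q.1 q.2 *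
      ((f (collide q.2 q.1).1 * f (collide q.2 q.1).2 - f q.1.1 * f q.1.2) *
        log (f (collide q.2 q.1).1 * f (collide q.2 q.1).2 / (f q.1.1 * f q.1.2)))) pairDirMeasure
    · rw [← hintRHS]; exact integral_mono hI (hRHS1.fun_add hRHS2) hpt
    · rw [integral_undef hI]
      have h1 : 0 ≤ Hl := by rw [hHl]; exact integral_nonneg fun q => mul_nonneg (hB0 q) (sq_nonneg _)
      have h2 : 0 ≤ J := by
        rw [hJ]; exact integral_nonneg fun q => mul_nonneg (mul_nonneg (hB0 q) (hb0 q).le) (sq_nonneg _)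
      positivity
  have hD : entropyProduction hardSphereKernel f = 4⁻¹ * ∫ q : PairDir, hardSphereKernel q.1 q.2 *
      ((f (collide q.2 q.1).1 * f (collide q.2 q.1).2 - f q.1.1 * f q.1.2) *
        log (f (collide q.2 q.1).1 * f (collide q.2 q.1).2 / (f q.1.1 * f q.1.2))) ∂pairDirMeasure := rfl
  rw [hD]
  calc 4⁻¹ * ∫ q : PairDir, hardSphereKernel q.1 q.2 *
        ((f (collide q.2 q.1).1 * f (collide q.2 q.1).2 - f q.1.1 * f q.1.2) *
          log (f (collide q.2 q.1).1 * f (collide q.2 q.1).2 / (f q.1.1 * f q.1.2))) ∂pairDirMeasure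
      ≤ 4⁻¹ * (3 * (2 + L) * Hl + (J + J) / L) := mul_le_mul_of_nonneg_left hmain (by norm_num)
    _ = 3 / 2 * (2 + L) * (fluxZ f * hellDiss f) + J / (2 * L) := by
        rw [hHl_eq]; field_simp; ring

end Integrated

end EEP

/-- Registered anchor of this helper file: the pointwise inequality behind step (i),
`(a − b) log(a/b) ≤ 3 (2 + L)(√a − √b)² + (a + b) W²/L` for `a, b, L > 0`, `W ≥ |log(a/b)|` (`EEP.sub_mul_log_div_le`). -/
theorem bhEEPClosure_entropy_anchor : ∀ (a b L W : ℝ), 0 < a → 0 < b → 0 < L → |Real.log (a / b)| ≤ W → (a - b) * Real.log (a / b) ≤ 3 * (2 + L) * (Real.sqrt a - Real.sqrt b) ^ 2 + (a + b) * W ^ 2 / L :=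
  fun _ _ _ _ ha hb hL hW => EEP.sub_mul_log_div_le ha hb hL hW

end

end Summit.AtomisticToContinuum.HydrodynamicLimit.Theorems.BlockHDissipation
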